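import Literature.MathematicalPhysics.QuantumFieldTheory.Balaban1983to89.B9Eq325QGGQInvZd

/-!
# `Balaban1983to89.B9Eq325ProjFormulaZd` — [Balaban1985BackgroundPropagators] (3.25) p. 394 «Rf = (I − G′Q′*(Q′G′²Q′*)⁻¹Q′G′)f» AT THE `ℤᵈ × 𝔸` CARRIERS,
# FOR THIS SEAT'S CONSTRUCTED PROJECTION `R(U₀)` (`B9Eq321LandauProjectionZd.projE`, the orthogonal projection onto the `𝔤`-valued range `Δ^η_{U₀}N_𝔤(Q′(U₀))`)
# AND THE CONSTRUCTED OPERATORS `G′(U₀) = (Ω₀Δ′_aΩ₀)⁻¹` (`B9Eq324DeltaPrimeAZd.GpZd`), `Q′`, `Q′*`, `(Q′G′²Q′*)⁻¹` (`B9Eq325QGGQInvZd`): at a UNITARY background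
# with UNITARY averaged transporters `Ū₀ʲ(Γ)` ([B7] Prop. 2's regime — displayed) and a tracial Hermitian faithful `τ`, the four operators commute with the
# involution `f ↦ f*`, and **(3.25) HOLDS ON HERMITIAN (`𝔤`-valued) inputs**: `R(U₀)f = f − G′Q′*(Q′G′²Q′*)⁻¹Q′G′f` for every Hermitian `f ∈ L²(Ω₀, ·)` —
# the Lagrange-multiplier identity by which print analyses `R` (locality of `R` from the decay of `G′` and `(Q′G′²Q′*)⁻¹`, (3.63)–(3.68))

statement-level skeleton of published theorems with citation tags; proofs where landed; nothing here is a claim about the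
Yang–Mills mass gap

`[Balaban1985BackgroundPropagators]` ("B9", CMP **99** (1985) 389–434) p. 394: *«R = R(U) is an orthogonal projection in the Hilbert space L²(Ω₀, 𝔤) onto the
subspace R = Δ^η_U N(Q′), N(Q′) = {λ : Q′λ = 0}. (3.21) … Using the Lagrange multipliers method the minimum of (3.22) can be found by the same calculations
as in [4], (2.15)–(2.17), and we obtain the formula Rf = (I − G′Q′*(Q′G′²Q′*)⁻¹Q′G′)f, (3.25) where G′ = G′(U) = (Δ′_a)⁻¹.»*  `[Balaban1984PropagatorsI]` ("B5")
(1.42)–(1.44) p. 25 and `[Balaban1984PropagatorsII]` ("B6") (2.15)–(2.17) — the Lagrange-multiplier algebra (kernel-checked abstractly in the tree: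
`B5Projector144`, `B9Eq325Proj`, `B9Eq325ProjFormula` — real ∕ `RCLike` inner-product spaces; HERE: the `ℤᵈ × 𝔸` carrier with the bilinear pairing `formE`).
PDF held: `paper:balaban1985-cmp99-background-propagators` p. 394 (re-read by this seat, 2026-08-28).

CITATION HEADER (lean-in-tree rule).  Cell `pub-ymgap` (YM Track A, HUMAN RULING D-0062 ∕ D-0149 width push), DAG node N06 = [B9], width seat
`pub-ymgap-dag-n06-w4` (g2), successor pointer (c) of this seat's g0 HANDOFF («R(U₀) = print's (3.25) formula when the inverses exist»).  g0 built
`R(U₀)` as the orthogonal projection (3.21)–(3.22); g2 built the inverses (Thm 3.11's «obvious» operators, every unitary `U₀`).  THE READING ISSUE located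
by g2 (INBOX l.26923): g0's `projE` projects onto the span of `𝟙_{Ω₀}Δ^η_{U₀}λ` over HERMITIAN `λ` (print's `L²(Ω₀, 𝔤)`), whereas `I − G′Q′*cQ′G′` on all
`𝔸`-valued functions projects onto `Δ^η_{U₀}N(Q′)` with `N` the full kernel; the two agree exactly on Hermitian inputs, which is where print uses `R`
(`R D^{η*}_U A`, `A` `𝔤`-valued) — and that is the theorem below.  The one displayed hypothesis beyond unitarity of `U₀` is the unitarity of the block
transporters `bgT L U₀ j z y = Ū₀ʲ(Γ_{z,y})` (so that `Q′_j(U₀)` commutes with `*`): [B7] Prop. 2 gives it in the small-field class (`B7Prop2Explicit.avgIter_mem`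
with `avgClosed_unitaryUnits`), NOT proved here.

WHAT IS DECLARED ∕ PROVED (kernel, 0 sorry; definitions with bodies + theorems; no `instance`, no `notation`).
* §1 `starFun f` (`x ↦ f(x)*`), `starSub` (the involution of `L²(Ω₀, ·)`), `starLev` (of `L²(𝔅, ·)`); `eq_of_fibreForm_eq` (non-degeneracy as an extensionality).
* §2 STAR-COMPATIBILITY at a unitary `U₀` with unitary `bgT` (tracial Hermitian faithful `τ`): `star_QprimeIter`, ★ `star_transposeOn` (the Riesz transpose of a
  `*`-compatible `T` is `*`-compatible), `star_deltaPrimeAZd`, `starSub_deltaPrimeADom`, ★ `starSub_GpZd` (`G′(f*) = (G′f)*` — inverse of a `*`-compatible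
  bijection), `starLev_QprimeVec`, `starSub_QprimeStar`, `starLev_qggq`, ★ `starLev_cZd`.
* §3 THE LAGRANGE-MULTIPLIER ALGEBRA for `Rop f := f − G′Q′*cQ′G′f`: `QprimeVec_GpZd_Rop` (`Q′G′(Rf) = 0`), `Rop_eq_indicator_covLap` (`Rf = 𝟙_{Ω₀}Δ^η_{U₀}λ₀`,
  `λ₀ = G′Rf ∈ N(Q′)`), `formE_sub_Rop_rangeGen` (`f − Rf ⊥ 𝟙_{Ω₀}Δ^η_{U₀}λ` for every `λ ∈ N_𝔤(Q′)`), `isSelfAdjoint_lam0` (for Hermitian `f`, `λ₀` is Hermitian).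
* §4 ★★★ `projE_eq_Rop_of_herm` — **(3.25) FOR THE CONSTRUCTED `R(U₀)` ON HERMITIAN INPUTS**: `projE τ s L m η (↑Λ ·) U₀ f = f − G′(Q′*(c(Q′(G′f))))` for
  `f ∈ L²(Ω₀, ·)` Hermitian-valued, every unitary `U₀` with unitary averaged transporters, `a ≥ 0` (ANY admissible weights — `R` does not depend on them), finite
  `Ω₀`, `0 < d`, `η ≠ 0`, `Q′*` injective; A6 `projE_eq_Rop_of_herm_flat` (at `U₀ = 1` the unitarity hypotheses hold by `bgT_one` — only `Q′*`-injectivity left,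
  inhabited at `m = 0` by `B9Eq325QGGQInvZd.qprimeStarInjective_levelZero`).

HONEST SCOPE.  (i) An identity between this seat's OBJECTS; no estimate; the displayed `hT` (unitary `Ū₀ʲ(Γ)`) is [B7] Prop. 2's conclusion in the small-field
class, not derived; the injectivity of `Q′*` is `B9Eq325QGGQInvZd`'s displayed clause.  (ii) On NON-Hermitian inputs `projE` and the formula differ (located,
l.26923) — print never applies `R` there.  (iii) `τ` a PARAMETER (tracial, Hermitian, faithful), `𝔸` finite-dimensional — no instance.  (iv) Count-neutral;
N05 ∕ N06 NOT discharged; K1⁷ `stmt-QuantumFields-20542` NOT closed; one finite `𝕋⁴` programme at fixed `ε`, Bałaban as printed; R4 closes only the conditional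
finite-`𝕋⁴` rung `BalabanLadder.UV` — nothing continuum ∕ ℝ⁴ ∕ OS ∕ mass gap ∕ Clay.  Unit `pub-ymgap-dag-n06-w4` (g2), 2026-08-28.
-/

noncomputable section

namespace Literature.MathematicalPhysics.QuantumFieldTheory.Balaban1983to89.B9Eq325ProjFormulaZd

open B7Prop1Explicit B7Eq78Linearization
open B7Prop2Explicit (unitaryUnits)
open B8Ineq132 (covDerivFwd)
open B8Eq119TwistedAxial (bgT)
open B8Eq138LandauZd (covLap)
open B9Eq321LandauProjectionZd (suppSub formE projE rangeSub rangeGen gaugeNull indicator_mem_suppSub formE_apply formE_isSymm star_covLap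
  star_conjR_of_mem_unitaryUnits projE_eq_projection isCompl_rangeSub_orthogonal)
open B9Eq324DeltaPrimeAZd (fibreForm fibreForm_apply fibreForm_comm fibreForm_nondegenerate riesz fibreForm_riesz single transposeOn re_trace_transposeOn
  QprimeLin QprimeLin_apply restrictSite restrictSite_coe deltaPrimeAZd deltaPrimeAZd_apply deltaPrimeADom deltaPrimeADom_coe GpZd deltaPrimeADom_GpZd
  GpZd_deltaPrimeADom deltaPrimeADom_bijective formE_GpZd_symm)
open B9Eq325QGGQInvZd (levSupp QprimeVec QprimeVec_apply_of_mem QprimeStar QprimeStar_coe formE_qprimeStar qggq qggq_apply QprimeStarInjective cZd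
  qggq_cZd cZd_qggq qggq_bijective)

-- `Site` alone could resolve to the torus sites of `Setup.lean`; re-export the `ℤ^d` sites of `B7Prop1Explicit`.
export B7Prop1Explicit (Site)

variable {d : ℕ} {𝔸 : Type*} [CStarAlgebra 𝔸]

/-! ## §1  The involution `f ↦ f*` on the carriers; non-degeneracy as extensionality -/

section Star

/-- `f* : x ↦ f(x)*` on functions. [cite: Balaban1985BackgroundPropagators, (3.21) p.394 («L²(Ω₀, 𝔤)» — the Hermitian part)] -/
def starFun {ι : Type*} (f : ι → 𝔸) : ι → 𝔸 := fun x => star (f x)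

/-- `starFun`, unfolded. [cite: Balaban1985BackgroundPropagators, (3.21) p.394 (bookkeeping)] -/
@[simp] theorem starFun_apply {ι : Type*} (f : ι → 𝔸) (x : ι) : starFun f x = star (f x) := rfl

/-- `f** = f`. [cite: Balaban1985BackgroundPropagators, (3.21) p.394 (bookkeeping)] -/
@[simp] theorem starFun_starFun {ι : Type*} (f : ι → 𝔸) : starFun (starFun f) = f := by
  funext x; simp [starFun]

/-- **THE INVOLUTION OF `L²(Ω₀, ·)`** (supports are preserved). [cite: Balaban1985BackgroundPropagators, (3.21) p.394] -/
def starSub {s : Finset (Site d)} (f : suppSub (𝔸 := 𝔸) s) : suppSub (𝔸 := 𝔸) s :=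
  ⟨starFun (f : Site d → 𝔸), fun x hx => by rw [starFun_apply, f.2 x hx, star_zero]⟩

/-- `starSub`, unfolded. [cite: Balaban1985BackgroundPropagators, (3.21) p.394 (bookkeeping)] -/
@[simp] theorem coe_starSub {s : Finset (Site d)} (f : suppSub (𝔸 := 𝔸) s) : ((starSub f : suppSub (𝔸 := 𝔸) s) : Site d → 𝔸) = starFun (f : Site d → 𝔸) := rfl

/-- `starSub` is an involution. [cite: Balaban1985BackgroundPropagators, (3.21) p.394 (bookkeeping)] -/
@[simp] theorem starSub_starSub {s : Finset (Site d)} (f : suppSub (𝔸 := 𝔸) s) : starSub (starSub f) = f :=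
  Subtype.ext (starFun_starFun _)

/-- **THE INVOLUTION OF `L²(𝔅, ·)`.** [cite: Balaban1985BackgroundPropagators, (3.24) p.394] -/
def starLev {m : ℕ} {Λ : ℕ → Finset (Site d)} (φ : levSupp (𝔸 := 𝔸) m Λ) : levSupp (𝔸 := 𝔸) m Λ :=
  ⟨starFun (φ : ℕ × Site d → 𝔸), fun p hp => by rw [starFun_apply, φ.2 p hp, star_zero]⟩

/-- `starLev`, unfolded. [cite: Balaban1985BackgroundPropagators, (3.24) p.394 (bookkeeping)] -/
@[simp] theorem coe_starLev {m : ℕ} {Λ : ℕ → Finset (Site d)} (φ : levSupp (𝔸 := 𝔸) m Λ) :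
    ((starLev φ : levSupp (𝔸 := 𝔸) m Λ) : ℕ × Site d → 𝔸) = starFun (φ : ℕ × Site d → 𝔸) := rfl

/-- `starLev` is an involution. [cite: Balaban1985BackgroundPropagators, (3.24) p.394 (bookkeeping)] -/
@[simp] theorem starLev_starLev {m : ℕ} {Λ : ℕ → Finset (Site d)} (φ : levSupp (𝔸 := 𝔸) m Λ) : starLev (starLev φ) = φ :=
  Subtype.ext (starFun_starFun _)

variable (τ : 𝔸 →ₗ[ℂ] ℂ)

/-- **NON-DEGENERACY AS EXTENSIONALITY**: `a = b` as soon as `Re τ(a* X) = Re τ(b* X)` for all `X` (faithful `τ`). [cite: Balaban1985BackgroundPropagators, p.390 («|X|² = tr X*X»)] -/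
theorem eq_of_fibreForm_eq (hτp : ∀ a : 𝔸, a ≠ 0 → 0 < (τ (star a * a)).re) {a b : 𝔸} (h : ∀ X : 𝔸, (τ (star a * X)).re = (τ (star b * X)).re) :
    a = b := by
  have hab : ∀ X : 𝔸, fibreForm τ (a - b) X = 0 := fun X => by
    rw [map_sub, LinearMap.sub_apply, fibreForm_apply, fibreForm_apply, h X, sub_self]
  exact sub_eq_zero.1 ((fibreForm_nondegenerate τ hτp).1 (a - b) hab)

/-- `Re τ((a*)* X) = Re τ(a* X*)` for a tracial Hermitian `τ` — the involution is «symmetric» for the fibre pairing. [cite: Balaban1985BackgroundPropagators, p.391 («X·Y = tr XY»)] -/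
theorem re_trace_star_star_mul (hτt : ∀ a b : 𝔸, τ (a * b) = τ (b * a)) (hτs : ∀ a : 𝔸, τ (star a) = starRingEnd ℂ (τ a)) (a X : 𝔸) :
    (τ (star (star a) * X)).re = (τ (star a * star X)).re := by
  rw [star_star, hτt a X]
  have h : X * a = star (star a * star X) := by rw [star_mul, star_star, star_star]
  rw [h, hτs, Complex.conj_re]

end Star

/-! ## §2  Star-compatibility of `Q′_j`, the Riesz transposes, `Δ′_a`, `G′`, `Q′`, `Q′*`, `Q′G′²Q′*`, `(Q′G′²Q′*)⁻¹` -/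

section Compat

variable {L : ℕ} {U₀ : Site d → Fin d → 𝔸ˣ} (η : ℝ) (τ : 𝔸 →ₗ[ℂ] ℂ)

/-- **`Q′_j(U₀)(f*) = (Q′_j(U₀)f)*`** when the averaged transporters `Ū₀ʲ(Γ_{z,y})` (`bgT`) are UNITARY ([B7] Prop. 2's regime): each one-step average
`Σ_x L⁻ᵈ R(T_x) f(x)` commutes with `*` (`(R(u)a)* = R(u)a*` for unitary `u`). [cite: Balaban1985BackgroundPropagators, (3.19) p.393; Balaban1985Averaging, Prop. 2 p.26] -/
theorem star_QprimeIter (hT : ∀ (j : ℕ) (z y : Site d), bgT L U₀ j z y ∈ unitaryUnits 𝔸) (f : Site d → 𝔸) :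
    ∀ (j : ℕ) (y : Site d), star (QprimeIter (zdBlocking d L) (bgT L U₀) j f y) = QprimeIter (zdBlocking d L) (bgT L U₀) j (starFun f) y := by
  intro j
  induction j with
  | zero => intro y; rfl
  | succ j ih =>
    intro y
    rw [QprimeIter_succ, QprimeIter_succ, Qprime, Qprime, star_sum]
    refine Finset.sum_congr rfl fun x _ => ?_
    rw [star_smul, star_trivial, star_conjR_of_mem_unitaryUnits (hT j y x), ih x]

variable [FiniteDimensional ℝ 𝔸] (hτp : ∀ a : 𝔸, a ≠ 0 → 0 < (τ (star a * a)).re)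

/-- ★ **THE RIESZ TRANSPOSE OF A `*`-COMPATIBLE OPERATOR IS `*`-COMPATIBLE**: if `T(g*) = (Tg)*` then `Tᵀ_Λ(g*) = (Tᵀ_Λ g)*` (tracial Hermitian faithful `τ`).
[cite: Balaban1985BackgroundPropagators, (3.24) p.394, p.391 («the adjoints …»)] -/
theorem star_transposeOn (hτt : ∀ a b : 𝔸, τ (a * b) = τ (b * a)) (hτs : ∀ a : 𝔸, τ (star a) = starRingEnd ℂ (τ a))
    {ι : Type*} (T : (ι → 𝔸) →ₗ[ℝ] (ι → 𝔸)) (hTstar : ∀ g : ι → 𝔸, T (starFun g) = starFun (T g)) (Λ : Finset ι) (g : ι → 𝔸) (i : ι) :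
    star (transposeOn τ hτp T Λ g i) = transposeOn τ hτp T Λ (starFun g) i := by
  refine eq_of_fibreForm_eq τ hτp fun X => ?_
  rw [re_trace_star_star_mul τ hτt hτs, re_trace_transposeOn, re_trace_transposeOn]
  have hsingle : single i (star X) = starFun (single (ι := ι) i X) := by
    funext k
    by_cases hk : k = i <;> simp [single, starFun, hk]
  rw [hsingle, hTstar]
  refine Finset.sum_congr rfl fun c _ => ?_
  rw [starFun_apply, starFun_apply, star_star, hτt]
  have h : g c * T (single i X) c = star (star (T (single i X) c) * star (g c)) := by rw [star_mul, star_star, star_star]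
  rw [h, hτs, Complex.conj_re]

variable {η}

omit [FiniteDimensional ℝ 𝔸] in
/-- `Δ^η_{U₀}` as a linear map commutes with `*` at a unitary background (g0's `star_covLap`). [cite: Balaban1985BackgroundPropagators, (3.23) p.394] -/
theorem covLap_starFun (hU : ∀ (x : Site d) (κ : Fin d), U₀ x κ ∈ unitaryUnits 𝔸) (f : Site d → 𝔸) :
    covLap η U₀ (starFun f) = starFun (covLap η U₀ f) := by
  funext x
  rw [starFun_apply, star_covLap η hU]
  rfl

variable {m : ℕ} {a : ℕ → ℝ} {Λ : ℕ → Finset (Site d)} {s : Finset (Site d)}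

/-- **`Δ′_a(U₀)(f*) = (Δ′_a(U₀)f)*`** (unitary `U₀`, unitary averaged transporters, tracial Hermitian faithful `τ`).
[cite: Balaban1985BackgroundPropagators, (3.24) p.394] -/
theorem deltaPrimeAZd_starFun (hτt : ∀ a b : 𝔸, τ (a * b) = τ (b * a)) (hτs : ∀ a : 𝔸, τ (star a) = starRingEnd ℂ (τ a))
    (hU : ∀ (x : Site d) (κ : Fin d), U₀ x κ ∈ unitaryUnits 𝔸) (hT : ∀ (j : ℕ) (z y : Site d), bgT L U₀ j z y ∈ unitaryUnits 𝔸) (f : Site d → 𝔸) :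
    deltaPrimeAZd L U₀ η τ hτp m a Λ (starFun f) = starFun (deltaPrimeAZd L U₀ η τ hτp m a Λ f) := by
  have hQ : ∀ (j : ℕ) (g : Site d → 𝔸), QprimeLin L U₀ j (starFun g) = starFun (QprimeLin L U₀ j g) := by
    intro j g
    funext y
    rw [QprimeLin_apply, QprimeLin_apply, starFun_apply, star_QprimeIter hT g j y]
  funext x
  rw [deltaPrimeAZd_apply, starFun_apply, deltaPrimeAZd_apply, star_add, star_sum, covLap_starFun hU, starFun_apply]
  congr 1
  refine Finset.sum_congr rfl fun j _ => ?_
  rw [star_smul, star_trivial, star_transposeOn τ hτp hτt hτs (QprimeLin L U₀ j) (hQ j) (Λ j)]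
  congr 2
  have := hQ j f
  rw [QprimeLin_apply, QprimeLin_apply] at this
  exact this

/-- **`Ω₀Δ′_a(U₀)Ω₀` COMMUTES WITH THE INVOLUTION.** [cite: Balaban1985BackgroundPropagators, (3.24) p.394] -/
theorem starSub_deltaPrimeADom (hτt : ∀ a b : 𝔸, τ (a * b) = τ (b * a)) (hτs : ∀ a : 𝔸, τ (star a) = starRingEnd ℂ (τ a))
    (hU : ∀ (x : Site d) (κ : Fin d), U₀ x κ ∈ unitaryUnits 𝔸) (hT : ∀ (j : ℕ) (z y : Site d), bgT L U₀ j z y ∈ unitaryUnits 𝔸) (f : suppSub (𝔸 := 𝔸) s) :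
    deltaPrimeADom L U₀ η τ hτp m a Λ s (starSub f) = starSub (deltaPrimeADom L U₀ η τ hτp m a Λ s f) := by
  apply Subtype.ext
  rw [deltaPrimeADom_coe, coe_starSub, coe_starSub, deltaPrimeADom_coe, deltaPrimeAZd_starFun τ hτp hτt hτs hU hT]
  funext x
  by_cases hx : x ∈ (↑s : Set (Site d))
  · rw [Set.indicator_of_mem hx, starFun_apply, starFun_apply, Set.indicator_of_mem hx]
  · rw [Set.indicator_of_notMem hx, starFun_apply, Set.indicator_of_notMem hx, star_zero]

/-- ★ **`G′(U₀)(f*) = (G′(U₀)f)*`** — the inverse of the `*`-compatible bijection `Ω₀Δ′_aΩ₀`. [cite: Balaban1985BackgroundPropagators, (3.24)–(3.25) p.394] -/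
theorem starSub_GpZd (hd : 0 < d) (hη : η ≠ 0) (hτt : ∀ a b : 𝔸, τ (a * b) = τ (b * a)) (hτs : ∀ a : 𝔸, τ (star a) = starRingEnd ℂ (τ a))
    (hU : ∀ (x : Site d) (κ : Fin d), U₀ x κ ∈ unitaryUnits 𝔸) (ha : ∀ j, 0 ≤ a j) (hT : ∀ (j : ℕ) (z y : Site d), bgT L U₀ j z y ∈ unitaryUnits 𝔸)
    (f : suppSub (𝔸 := 𝔸) s) :
    GpZd L U₀ η τ hτp m a Λ s hd hη hτt hτs hU ha (starSub f) = starSub (GpZd L U₀ η τ hτp m a Λ s hd hη hτt hτs hU ha f) := by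
  apply (deltaPrimeADom_bijective L U₀ η τ hτp m a Λ s hd hη hτt hτs hU ha).1
  rw [deltaPrimeADom_GpZd hd hη hτt hτs hU ha, starSub_deltaPrimeADom τ hτp hτt hτs hU hT, deltaPrimeADom_GpZd hd hη hτt hτs hU ha]

omit [FiniteDimensional ℝ 𝔸] in
/-- **`Q′(f*) = (Q′f)*`** on `L²(Ω₀, ·) → L²(𝔅, ·)` (unitary averaged transporters). [cite: Balaban1985BackgroundPropagators, (3.19) p.393] -/
theorem starLev_QprimeVec (hT : ∀ (j : ℕ) (z y : Site d), bgT L U₀ j z y ∈ unitaryUnits 𝔸) (f : suppSub (𝔸 := 𝔸) s) :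
    QprimeVec L U₀ m Λ s (starSub f) = starLev (QprimeVec L U₀ m Λ s f) := by
  classical
  apply Subtype.ext
  funext p
  show (if p.1 ∈ Finset.range (m + 1) ∧ p.2 ∈ Λ p.1 then QprimeIter (zdBlocking d L) (bgT L U₀) p.1 (starFun (f : Site d → 𝔸)) p.2 else 0) =
    star (if p.1 ∈ Finset.range (m + 1) ∧ p.2 ∈ Λ p.1 then QprimeIter (zdBlocking d L) (bgT L U₀) p.1 (f : Site d → 𝔸) p.2 else 0)
  split_ifs with h
  · rw [star_QprimeIter hT]
  · rw [star_zero]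

/-- **`Q′*(φ*) = (Q′*φ)*`** (the Riesz transposes are `*`-compatible). [cite: Balaban1985BackgroundPropagators, (3.25) p.394] -/
theorem starSub_QprimeStar (hτt : ∀ a b : 𝔸, τ (a * b) = τ (b * a)) (hτs : ∀ a : 𝔸, τ (star a) = starRingEnd ℂ (τ a))
    (hT : ∀ (j : ℕ) (z y : Site d), bgT L U₀ j z y ∈ unitaryUnits 𝔸) (φ : levSupp (𝔸 := 𝔸) m Λ) :
    QprimeStar L U₀ τ m Λ s hτp (starLev φ) = starSub (QprimeStar L U₀ τ m Λ s hτp φ) := by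
  have hQ : ∀ (j : ℕ) (g : Site d → 𝔸), QprimeLin L U₀ j (starFun g) = starFun (QprimeLin L U₀ j g) := by
    intro j g
    funext y
    rw [QprimeLin_apply, QprimeLin_apply, starFun_apply, star_QprimeIter hT g j y]
  apply Subtype.ext
  rw [QprimeStar_coe, coe_starSub, QprimeStar_coe]
  funext x
  by_cases hx : x ∈ (↑s : Set (Site d))
  · rw [Set.indicator_of_mem hx, starFun_apply, Set.indicator_of_mem hx, Finset.sum_apply, Finset.sum_apply, star_sum]
    refine Finset.sum_congr rfl fun j _ => ?_
    rw [star_transposeOn τ hτp hτt hτs (QprimeLin L U₀ j) (hQ j) (Λ j)]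
    rfl
  · rw [Set.indicator_of_notMem hx, starFun_apply, Set.indicator_of_notMem hx, star_zero]

variable (hd : 0 < d) (hη : η ≠ 0) (hτt : ∀ a b : 𝔸, τ (a * b) = τ (b * a)) (hτs : ∀ a : 𝔸, τ (star a) = starRingEnd ℂ (τ a))
  (hU : ∀ (x : Site d) (κ : Fin d), U₀ x κ ∈ unitaryUnits 𝔸) (ha : ∀ j, 0 ≤ a j) (hT : ∀ (j : ℕ) (z y : Site d), bgT L U₀ j z y ∈ unitaryUnits 𝔸)

include hT in
/-- **`Q′G′²Q′*` COMMUTES WITH THE INVOLUTION.** [cite: Balaban1985BackgroundPropagators, (3.25) p.394] -/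
theorem starLev_qggq (φ : levSupp (𝔸 := 𝔸) m Λ) :
    qggq L U₀ η τ hτp m a Λ s hd hη hτt hτs hU ha (starLev φ) = starLev (qggq L U₀ η τ hτp m a Λ s hd hη hτt hτs hU ha φ) := by
  rw [qggq_apply, qggq_apply, starSub_QprimeStar τ hτp hτt hτs hT, starSub_GpZd τ hτp hd hη hτt hτs hU ha hT, starSub_GpZd τ hτp hd hη hτt hτs hU ha hT,
    starLev_QprimeVec hT]

include hT in
/-- ★ **`(Q′G′²Q′*)⁻¹(φ*) = ((Q′G′²Q′*)⁻¹φ)*`.** [cite: Balaban1985BackgroundPropagators, (3.25) p.394] -/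
theorem starLev_cZd (hinj : QprimeStarInjective L U₀ τ hτp m Λ s) (φ : levSupp (𝔸 := 𝔸) m Λ) :
    cZd L U₀ η τ hτp m a Λ s hd hη hτt hτs hU ha hinj (starLev φ) = starLev (cZd L U₀ η τ hτp m a Λ s hd hη hτt hτs hU ha hinj φ) := by
  apply (qggq_bijective L U₀ η τ hτp m a Λ s hd hη hτt hτs hU ha hinj).1
  rw [qggq_cZd, starLev_qggq τ hτp hd hη hτt hτs hU ha hT, qggq_cZd]

end Compat

/-! ## §3  The Lagrange-multiplier algebra for `R f := f − G′Q′*(Q′G′²Q′*)⁻¹Q′G′f` -/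

section Lagrange

variable (L : ℕ) (U₀ : Site d → Fin d → 𝔸ˣ) (η : ℝ) (τ : 𝔸 →ₗ[ℂ] ℂ) [FiniteDimensional ℝ 𝔸]
  (hτp : ∀ a : 𝔸, a ≠ 0 → 0 < (τ (star a * a)).re) (m : ℕ) (a : ℕ → ℝ) (Λ : ℕ → Finset (Site d)) (s : Finset (Site d))
  (hd : 0 < d) (hη : η ≠ 0) (hτt : ∀ a b : 𝔸, τ (a * b) = τ (b * a)) (hτs : ∀ a : 𝔸, τ (star a) = starRingEnd ℂ (τ a))
  (hU : ∀ (x : Site d) (κ : Fin d), U₀ x κ ∈ unitaryUnits 𝔸) (ha : ∀ j, 0 ≤ a j) (hinj : QprimeStarInjective L U₀ τ hτp m Λ s)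

/-- **PRINT'S (3.25) OPERATOR ON THE CONSTRUCTED LETTERS**: `R f := f − G′(Q′*((Q′G′²Q′*)⁻¹(Q′(G′f))))` on `L²(Ω₀, ·)`.
[cite: Balaban1985BackgroundPropagators, (3.25) p.394] -/
def Rop (f : suppSub (𝔸 := 𝔸) s) : suppSub (𝔸 := 𝔸) s :=
  f - GpZd L U₀ η τ hτp m a Λ s hd hη hτt hτs hU ha
        (QprimeStar L U₀ τ m Λ s hτp
          (cZd L U₀ η τ hτp m a Λ s hd hη hτt hτs hU ha hinj
            (QprimeVec L U₀ m Λ s (GpZd L U₀ η τ hτp m a Λ s hd hη hτt hτs hU ha f))))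

/-- `Rop`, unfolded. [cite: Balaban1985BackgroundPropagators, (3.25) p.394 (bookkeeping)] -/
theorem Rop_def (f : suppSub (𝔸 := 𝔸) s) :
    Rop L U₀ η τ hτp m a Λ s hd hη hτt hτs hU ha hinj f =
      f - GpZd L U₀ η τ hτp m a Λ s hd hη hτt hτs hU ha
        (QprimeStar L U₀ τ m Λ s hτp
          (cZd L U₀ η τ hτp m a Λ s hd hη hτt hτs hU ha hinj
            (QprimeVec L U₀ m Λ s (GpZd L U₀ η τ hτp m a Λ s hd hη hτt hτs hU ha f)))) := rfl

/-- **`Q′G′(Rf) = 0`** — the multiplier is chosen so that `λ₀ := G′Rf` satisfies the constraint «Q′λ₀ = 0» ((3.22): λ₀ ∈ N(Q′)).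
[cite: Balaban1985BackgroundPropagators, (3.22), (3.25) p.394; Balaban1984PropagatorsI, (1.43) p.25] -/
theorem QprimeVec_GpZd_Rop (f : suppSub (𝔸 := 𝔸) s) :
    QprimeVec L U₀ m Λ s (GpZd L U₀ η τ hτp m a Λ s hd hη hτt hτs hU ha (Rop L U₀ η τ hτp m a Λ s hd hη hτt hτs hU ha hinj f)) = 0 := by
  rw [Rop_def, map_sub, map_sub, ← qggq_apply, qggq_cZd, sub_self]

/-- the penalty's transpose of a function vanishing on the level set is `0`. [cite: Balaban1985BackgroundPropagators, (3.24) p.394 (bookkeeping)] -/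
theorem transposeOn_eq_zero_of_forall {ι : Type*} (T : (ι → 𝔸) →ₗ[ℝ] (ι → 𝔸)) (Λ' : Finset ι) {g : ι → 𝔸} (hg : ∀ c ∈ Λ', g c = 0) :
    transposeOn τ hτp T Λ' g = 0 := by
  funext i
  rw [Pi.zero_apply]
  refine eq_of_fibreForm_eq τ hτp fun X => ?_
  rw [re_trace_transposeOn, star_zero, zero_mul, map_zero, Complex.zero_re]
  exact Finset.sum_eq_zero fun c hc => by rw [hg c hc, mul_zero, map_zero, Complex.zero_re]

/-- **ON `N(Q′)` THE PENALTY VANISHES: `Ω₀Δ′_aΩ₀ λ = 𝟙_{Ω₀}Δ^η_{U₀}λ`** for `λ ∈ L²(Ω₀, ·)` with `Q′_jλ = 0` on `Λ_j`, `j ≤ m` (B5's «Δ′_a agrees with Δ on N(Q′)»).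
[cite: Balaban1985BackgroundPropagators, (3.24) p.394; Balaban1984PropagatorsI, (1.42)–(1.44) p.25] -/
theorem deltaPrimeADom_of_ker (lam : suppSub (𝔸 := 𝔸) s)
    (hker : ∀ j ∈ Finset.range (m + 1), ∀ y ∈ Λ j, QprimeIter (zdBlocking d L) (bgT L U₀) j (lam : Site d → 𝔸) y = 0) :
    (deltaPrimeADom L U₀ η τ hτp m a Λ s lam : Site d → 𝔸) = (↑s : Set (Site d)).indicator (covLap η U₀ (lam : Site d → 𝔸)) := by
  rw [deltaPrimeADom_coe]
  congr 1
  funext x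
  rw [deltaPrimeAZd_apply, add_eq_left]
  refine Finset.sum_eq_zero fun j hj => ?_
  rw [transposeOn_eq_zero_of_forall τ hτp (QprimeLin L U₀ j) (Λ j) (hker j hj), Pi.zero_apply, smul_zero]

/-- **`Rf = 𝟙_{Ω₀}Δ^η_{U₀}λ₀` with `λ₀ := G′Rf ∈ N(Q′)`** ((3.22) «Rf = Δ^η_Uλ₀»). [cite: Balaban1985BackgroundPropagators, (3.22) p.394; Balaban1984PropagatorsI, (1.43) p.25] -/
theorem Rop_eq_indicator_covLap (f : suppSub (𝔸 := 𝔸) s) :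
    ((Rop L U₀ η τ hτp m a Λ s hd hη hτt hτs hU ha hinj f : suppSub (𝔸 := 𝔸) s) : Site d → 𝔸) =
      (↑s : Set (Site d)).indicator (covLap η U₀
        ((GpZd L U₀ η τ hτp m a Λ s hd hη hτt hτs hU ha (Rop L U₀ η τ hτp m a Λ s hd hη hτt hτs hU ha hinj f) : suppSub (𝔸 := 𝔸) s) : Site d → 𝔸)) := by
  set lam := GpZd L U₀ η τ hτp m a Λ s hd hη hτt hτs hU ha (Rop L U₀ η τ hτp m a Λ s hd hη hτt hτs hU ha hinj f) with hlam
  have hker : ∀ j ∈ Finset.range (m + 1), ∀ y ∈ Λ j, QprimeIter (zdBlocking d L) (bgT L U₀) j (lam : Site d → 𝔸) y = 0 := by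
    intro j hj y hy
    have h := congrArg (fun φ : levSupp (𝔸 := 𝔸) m Λ => (φ : ℕ × Site d → 𝔸) (j, y)) (QprimeVec_GpZd_Rop L U₀ η τ hτp m a Λ s hd hη hτt hτs hU ha hinj f)
    simp only [Submodule.coe_zero, Pi.zero_apply] at h
    rwa [QprimeVec_apply_of_mem L U₀ m Λ s _ hj hy] at h
  rw [← deltaPrimeADom_of_ker L U₀ η τ hτp m a Λ s lam hker, hlam, deltaPrimeADom_GpZd hd hη hτt hτs hU ha]

/-- **`f − Rf ⊥ 𝟙_{Ω₀}Δ^η_{U₀}λ` FOR EVERY `λ ∈ N(Q′)`** («f − Rf ⊥ Δ^η_U N(Q′)»): `⟨𝟙Δλ, G′Q′*ψ⟩ = ⟨G′(Ω₀Δ′_aΩ₀ λ), Q′*ψ⟩ = ⟨λ, Q′*ψ⟩ = ⟨Q′λ, ψ⟩ = 0`.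
[cite: Balaban1985BackgroundPropagators, (3.21)–(3.22) p.394; Balaban1984PropagatorsI, (1.42)–(1.44) p.25] -/
theorem formE_indicator_covLap_sub_Rop (lam : suppSub (𝔸 := 𝔸) s)
    (hker : ∀ j ∈ Finset.range (m + 1), ∀ y ∈ Λ j, QprimeIter (zdBlocking d L) (bgT L U₀) j (lam : Site d → 𝔸) y = 0) (f : suppSub (𝔸 := 𝔸) s) :
    formE τ s (deltaPrimeADom L U₀ η τ hτp m a Λ s lam) (f - Rop L U₀ η τ hτp m a Λ s hd hη hτt hτs hU ha hinj f) = 0 := by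
  rw [Rop_def, sub_sub_cancel]
  set ψ := cZd L U₀ η τ hτp m a Λ s hd hη hτt hτs hU ha hinj (QprimeVec L U₀ m Λ s (GpZd L U₀ η τ hτp m a Λ s hd hη hτt hτs hU ha f))
  -- move `G′` across, cancel it against `Ω₀Δ′_aΩ₀`, then use the adjointness of `Q′*` and `Q′λ = 0`
  rw [← formE_GpZd_symm hd hη hτt hτs hU ha, GpZd_deltaPrimeADom hd hη hτt hτs hU ha,
    (formE_isSymm τ s hτs).eq lam, formE_qprimeStar L U₀ τ m Λ s hτp hτs]
  have hQ : QprimeVec L U₀ m Λ s lam = 0 := by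
    apply Subtype.ext
    funext p
    by_cases hp : p.1 ∈ Finset.range (m + 1) ∧ p.2 ∈ Λ p.1
    · rw [show p = (p.1, p.2) from rfl, QprimeVec_apply_of_mem L U₀ m Λ s lam hp.1 hp.2, hker p.1 hp.1 p.2 hp.2]
      rfl
    · exact (QprimeVec L U₀ m Λ s lam).2 p hp
  rw [hQ, map_zero]

variable (hT : ∀ (j : ℕ) (z y : Site d), bgT L U₀ j z y ∈ unitaryUnits 𝔸)

include hT in
/-- **`R` COMMUTES WITH THE INVOLUTION** (unitary `U₀`, unitary averaged transporters): `R(f*) = (Rf)*`. [cite: Balaban1985BackgroundPropagators, (3.25) p.394] -/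
theorem starSub_Rop (f : suppSub (𝔸 := 𝔸) s) :
    Rop L U₀ η τ hτp m a Λ s hd hη hτt hτs hU ha hinj (starSub f) = starSub (Rop L U₀ η τ hτp m a Λ s hd hη hτt hτs hU ha hinj f) := by
  rw [Rop_def, Rop_def, starSub_GpZd τ hτp hd hη hτt hτs hU ha hT f, starLev_QprimeVec hT, starLev_cZd τ hτp hd hη hτt hτs hU ha hT hinj,
    starSub_QprimeStar τ hτp hτt hτs hT, starSub_GpZd τ hτp hd hη hτt hτs hU ha hT]
  apply Subtype.ext
  funext x
  simp only [Submodule.coe_sub, Pi.sub_apply, coe_starSub, starFun_apply, star_sub]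

include hT in
/-- **FOR A HERMITIAN `f`, `λ₀ := G′Rf` IS HERMITIAN-VALUED** — so `Rf = 𝟙_{Ω₀}Δ^η_{U₀}λ₀` lies in the `𝔤`-valued range of this seat's `R(U₀)`.
[cite: Balaban1985BackgroundPropagators, (3.21)–(3.22) p.394 («L²(Ω₀, 𝔤)»)] -/
theorem isSelfAdjoint_lam0 {f : suppSub (𝔸 := 𝔸) s} (hf : starSub f = f) (x : Site d) :
    IsSelfAdjoint
      (((GpZd L U₀ η τ hτp m a Λ s hd hη hτt hτs hU ha (Rop L U₀ η τ hτp m a Λ s hd hη hτt hτs hU ha hinj f) : suppSub (𝔸 := 𝔸) s) :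
        Site d → 𝔸) x) := by
  have h : starSub (GpZd L U₀ η τ hτp m a Λ s hd hη hτt hτs hU ha (Rop L U₀ η τ hτp m a Λ s hd hη hτt hτs hU ha hinj f)) =
      GpZd L U₀ η τ hτp m a Λ s hd hη hτt hτs hU ha (Rop L U₀ η τ hτp m a Λ s hd hη hτt hτs hU ha hinj f) := by
    rw [← starSub_GpZd τ hτp hd hη hτt hτs hU ha hT, ← starSub_Rop L U₀ η τ hτp m a Λ s hd hη hτt hτs hU ha hinj hT, hf]
  have hx := congrArg (fun g : suppSub (𝔸 := 𝔸) s => (g : Site d → 𝔸) x) h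
  simp only [coe_starSub, starFun_apply] at hx
  exact hx

end Lagrange

/-! ## §4  (3.25) for the constructed `R(U₀)` on Hermitian inputs -/

section Formula

variable (L : ℕ) (U₀ : Site d → Fin d → 𝔸ˣ) (η : ℝ) (τ : 𝔸 →ₗ[ℂ] ℂ) [FiniteDimensional ℝ 𝔸]
  (hτp : ∀ a : 𝔸, a ≠ 0 → 0 < (τ (star a * a)).re) (m : ℕ) (a : ℕ → ℝ) (Λ : ℕ → Finset (Site d)) (s : Finset (Site d))
  (hd : 0 < d) (hη : η ≠ 0) (hτt : ∀ a b : 𝔸, τ (a * b) = τ (b * a)) (hτs : ∀ a : 𝔸, τ (star a) = starRingEnd ℂ (τ a))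
  (hU : ∀ (x : Site d) (κ : Fin d), U₀ x κ ∈ unitaryUnits 𝔸) (ha : ∀ j, 0 ≤ a j) (hinj : QprimeStarInjective L U₀ τ hτp m Λ s)
  (hT : ∀ (j : ℕ) (z y : Site d), bgT L U₀ j z y ∈ unitaryUnits 𝔸)

include hT in
/-- ★★★ **(3.25) FOR THIS SEAT'S CONSTRUCTED `R(U₀)` ON HERMITIAN INPUTS**: for `f ∈ L²(Ω₀, ·)` Hermitian-valued (`f* = f`), at every UNITARY background `U₀`
whose averaged transporters `Ū₀ʲ(Γ)` are unitary, for a tracial Hermitian faithful `τ` on a finite-dimensional `𝔸`, ANY weights `a ≥ 0`, finite `Ω₀`, `0 < d`,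
`η ≠ 0`, `Q′*` injective: `R(U₀)f = f − G′(Q′*((Q′G′²Q′*)⁻¹(Q′(G′f))))` — the orthogonal projection of (3.21)–(3.22) (`projE`, onto the span of `𝟙_{Ω₀}Δ^η_{U₀}λ`,
`λ ∈ N_𝔤(Q′(U₀))`) IS print's Lagrange-multiplier formula. [cite: Balaban1985BackgroundPropagators, (3.25) p.394, (3.21)–(3.22) p.394; Balaban1984PropagatorsI, (1.42)–(1.44) p.25] -/
theorem projE_eq_Rop_of_herm {f : suppSub (𝔸 := 𝔸) s} (hf : starSub f = f) :
    projE τ s L m η (fun j => (↑(Λ j) : Set (Site d))) U₀ f = Rop L U₀ η τ hτp m a Λ s hd hη hτt hτs hU ha hinj f := by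
  set R := Rop L U₀ η τ hτp m a Λ s hd hη hτt hτs hU ha hinj f with hRdef
  set lam := GpZd L U₀ η τ hτp m a Λ s hd hη hτt hτs hU ha R with hlam
  have hc := isCompl_rangeSub_orthogonal (s := s) (τ := τ) L m η (fun j => (↑(Λ j) : Set (Site d))) U₀ hτs hτp
  -- (i) `Rf ∈ Δ^η_{U₀}N_𝔤(Q′)`
  have hker : ∀ j ∈ Finset.range (m + 1), ∀ y ∈ Λ j, QprimeIter (zdBlocking d L) (bgT L U₀) j (lam : Site d → 𝔸) y = 0 := by
    intro j hj y hy
    have h := congrArg (fun φ : levSupp (𝔸 := 𝔸) m Λ => (φ : ℕ × Site d → 𝔸) (j, y)) (QprimeVec_GpZd_Rop L U₀ η τ hτp m a Λ s hd hη hτt hτs hU ha hinj f)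
    simp only [Submodule.coe_zero, Pi.zero_apply] at h
    rwa [QprimeVec_apply_of_mem L U₀ m Λ s _ hj hy] at h
  have hmem : R ∈ rangeSub s L m η (fun j => (↑(Λ j) : Set (Site d))) U₀ := by
    refine Submodule.subset_span ⟨(lam : Site d → 𝔸), ⟨?_, fun x hx => lam.2 x hx, ?_⟩, ?_⟩
    · exact fun x => isSelfAdjoint_lam0 L U₀ η τ hτp m a Λ s hd hη hτt hτs hU ha hinj hT hf x
    · intro j hj y hy
      exact hker j (Finset.mem_range.2 (Nat.lt_succ_of_le hj)) y (Finset.mem_coe.1 hy)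
    · exact Rop_eq_indicator_covLap L U₀ η τ hτp m a Λ s hd hη hτt hτs hU ha hinj f
  -- (ii) `f − Rf ⊥ Δ^η_{U₀}N_𝔤(Q′)`
  have horth : f - R ∈ (formE τ s).orthogonal (rangeSub s L m η (fun j => (↑(Λ j) : Set (Site d))) U₀) := by
    rw [LinearMap.BilinForm.mem_orthogonal_iff]
    intro w hw
    induction hw using Submodule.span_induction with
    | mem w hw =>
      obtain ⟨mu, ⟨_, hsupp, hQ⟩, hwmu⟩ := hw
      -- `w = 𝟙Δμ = Ω₀Δ′_aΩ₀ μ` since `Q′μ = 0` on the level sets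
      have hker' : ∀ j ∈ Finset.range (m + 1), ∀ y ∈ Λ j, QprimeIter (zdBlocking d L) (bgT L U₀) j
          (((⟨mu, hsupp⟩ : suppSub (𝔸 := 𝔸) s) : suppSub (𝔸 := 𝔸) s) : Site d → 𝔸) y = 0 :=
        fun j hj y hy => hQ j (Nat.le_of_lt_succ (Finset.mem_range.1 hj)) y (Finset.mem_coe.2 hy)
      have hw' : w = deltaPrimeADom L U₀ η τ hτp m a Λ s ⟨mu, hsupp⟩ :=
        Subtype.ext (by rw [hwmu, deltaPrimeADom_of_ker L U₀ η τ hτp m a Λ s ⟨mu, hsupp⟩ hker'])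
      show formE τ s w (f - R) = 0
      rw [hw']
      exact formE_indicator_covLap_sub_Rop L U₀ η τ hτp m a Λ s hd hη hτt hτs hU ha hinj ⟨mu, hsupp⟩ hker' f
    | zero =>
      show formE τ s 0 (f - R) = 0
      rw [map_zero, LinearMap.zero_apply]
    | add w₁ w₂ _ _ h₁ h₂ =>
      show formE τ s (w₁ + w₂) (f - R) = 0
      have e₁ : formE τ s w₁ (f - R) = 0 := h₁
      have e₂ : formE τ s w₂ (f - R) = 0 := h₂
      rw [map_add, LinearMap.add_apply, e₁, e₂, add_zero]
    | smul c w _ hw =>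
      show formE τ s (c • w) (f - R) = 0
      have e : formE τ s w (f - R) = 0 := hw
      rw [map_smul, LinearMap.smul_apply, e, smul_zero]
  -- (iii) uniqueness of the orthogonal decomposition
  rw [projE_eq_projection L m η _ U₀ hτs hτp]
  have hsplit : f = R + (f - R) := by abel
  conv_lhs => rw [hsplit]
  rw [map_add, Submodule.projection_apply_of_mem_left _ hmem, Submodule.projection_apply_of_mem_right _ horth, add_zero]

/-- **A6 ∕ NON-VACUITY — THE FLAT BACKGROUND**: at `U₀ = 1` every bond variable and every averaged transporter is `1` (`B8Eq119TwistedAxial.bgT_one`), so the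
displayed unitarity hypotheses hold and (3.25) for `R(1)` on Hermitian inputs follows with only `Q′*`-injectivity left (inhabited at `m = 0` by
`B9Eq325QGGQInvZd.qprimeStarInjective_levelZero`). [cite: Balaban1985BackgroundPropagators, (3.25) p.394] -/
theorem projE_eq_Rop_of_herm_flat (hinj₁ : QprimeStarInjective L (1 : Site d → Fin d → 𝔸ˣ) τ hτp m Λ s) {f : suppSub (𝔸 := 𝔸) s} (hf : starSub f = f) :
    projE τ s L m η (fun j => (↑(Λ j) : Set (Site d))) (1 : Site d → Fin d → 𝔸ˣ) f =
      Rop L 1 η τ hτp m a Λ s hd hη hτt hτs (fun _ _ => (unitaryUnits 𝔸).one_mem) ha hinj₁ f :=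
  projE_eq_Rop_of_herm L 1 η τ hτp m a Λ s hd hη hτt hτs (fun _ _ => (unitaryUnits 𝔸).one_mem) ha hinj₁
    (fun j z y => by rw [B8Eq119TwistedAxial.bgT_one]; exact (unitaryUnits 𝔸).one_mem) hf

end Formula

end Literature.MathematicalPhysics.QuantumFieldTheory.Balaban1983to89.B9Eq325ProjFormulaZd

end
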